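import Mathlib
import HarnessLib
import Literature.NumberTheory.DiophantineGeometry.IntegerGCDBound
import Literature.NumberTheory.DiophantineGeometry.IntegerGCDBoundExpPolyProofs
import Literature.NumberTheory.DiophantineGeometry.IntegerGCDBoundVectorsProofs

/-!
# The g.c.d. of `aⁿ − 1` and `bⁿ − 1` from the Subspace Theorem (Bugeaud–Corvaja–Zannier, Thm. 1)

Assembly of the reduction of the named fact
`Literature.NumberTheory.DiophantineGeometry.BugeaudCorvajaZannier2003_thm1` (`IntegerGCDBound.lean`;
Y. Bugeaud, P. Corvaja, U. Zannier, Math. Z. 243 (2003), Thm. 1 [BugeaudCorvajaZannier2003]) to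
the `p`-adic affine Subspace Theorem over `ℚ` (Schmidt 1972 / Schlickewei 1977; Bombieri–Gubler
Cor. 7.2.5 [BombieriGubler2006]), following B–G's proof of Thm. 7.4.10 (pp. 218–220) for the pairs
`(u, v) = (aⁿ, bⁿ)`; objects in `IntegerGCDBoundDefs.lean`, the end-game in
`IntegerGCDBoundExpPolyProofs.lean`, the point and the double product in
`IntegerGCDBoundVectorsProofs.lean`.

Main result: `BugeaudCorvajaZannier2003_thm1_of_subspaceTheorem (hST) : BugeaudCorvajaZannier2003_thm1`
where `hST` is the Subspace Theorem written out (it is the statement to be vendored as the named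
fact `Literature.NumberTheory.DiophantineApproximation.SubspaceTheorem`; a proving seat may not
introduce named facts, D-0026, so it is a hypothesis here and the fact
`BugeaudCorvajaZannier2003_thm1` stays CONDITIONAL on it — which is the true state of the art: no
proof of the g.c.d. bound avoiding the Subspace Theorem is known).

Steps proved here (B–G p. 220): from `g = gcd(aⁿ−1, bⁿ−1) > e^{εn}` the bounds
`c_i < a^{kn} e^{-εn}`, `d < bⁿ e^{-εn}` (B–G: `d ≤ 2|v|^{1−ε}`); (7.15)
`∏∏ |L_{νm}(x)|_ν < a^{k²n} b^{hn} e^{−εn(k+(k+1)h)} = e^{−nE}` (`double_product_lt_exp`); the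
choice `kε ≥ log b + 1`, `h ≥ k² log a + 1` making `E > 0` (B–G: "`k ≥ 2/ε` and `h ≥ k² + 1`") and
`δ = E/(k log a + h log b)`, whence `∏∏ < ‖x‖^{−δ}` (`subspace_ineq`); pigeonhole over the
finitely many exceptional subspaces (`exists_mem_infinite_fiber`); conclusion.

## References

* [BombieriGubler2006] E. Bombieri, W. Gubler, *Heights in Diophantine Geometry*, New Mathematical
  Monographs 4, CUP 2006, Thm. 7.4.10 and its proof (pp. 218–220), Cor. 7.2.5.
* [BugeaudCorvajaZannier2003] Y. Bugeaud, P. Corvaja, U. Zannier, *An upper bound for the G.C.D.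
  of `aⁿ − 1` and `bⁿ − 1`*, Math. Z. 243 (2003), 79–84, Thm. 1.
* [CorvajaZannier2002] P. Corvaja, U. Zannier, *On the greatest prime factor of `(ab+1)(ac+1)`*,
  Proc. Amer. Math. Soc. 131 (2003), 1705–1709.
-/

namespace Literature.NumberTheory.DiophantineGeometry

namespace BugeaudCorvajaZannier2003

open Finset

/-! ### The Subspace inequality `∏ < ‖x‖^{-δ}` (B–G (7.15) and the choice of `δ`) -/

section RealEstimate

variable {a b : ℕ} (ha : 2 ≤ a) (hb : 2 ≤ b) {k h : ℕ} (hk : 1 ≤ k) (hh : 1 ≤ h) {n : ℕ}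
  (hn : 1 ≤ n) {ε : ℝ}

/-- `cᵐ = exp(m log c)` for a positive integer `c`. [folklore] -/
theorem natCast_pow_eq_exp {c : ℕ} (hc : 0 < c) (m : ℕ) :
    (c : ℝ) ^ m = Real.exp (m * Real.log c) := by
  rw [Real.exp_nat_mul, Real.exp_log (by exact_mod_cast hc)]

include ha hn in
/-- `c_i < a^{kn} e^{-εn} = exp(kn log a − εn)` for `i < k`, when `g > e^{εn}`
(B–G: `|L_{∞ i}(x)| = O(d|u|^i |v|^{-1})` with `d ≤ 2|v|^{1-ε}`).
[cite: BombieriGubler2006, proof of Thm. 7.4.10] -/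
theorem cCoef_lt_exp (hg : Real.exp (ε * n) < gcdPow a b n) (i : Fin k) :
    (cCoef a b n i : ℝ) < Real.exp (k * n * Real.log a - ε * n) := by
  have ha0 : 0 < a := by omega
  have hcpos : (0 : ℝ) < cCoef a b n i := by exact_mod_cast cCoef_pos ha hn i
  have h1 : (cCoef a b n i : ℝ) * (gcdPow a b n : ℝ) = (a : ℝ) ^ ((i : ℕ) * n) * ((a : ℝ) ^ n - 1) :=
    cCoef_mul_gcdPow_cast (K := ℝ) ha i
  rw [Real.exp_sub, lt_div_iff₀ (Real.exp_pos _)]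
  have hapos : (0 : ℝ) < (a : ℝ) ^ ((i : ℕ) * n) := by positivity
  calc (cCoef a b n i : ℝ) * Real.exp (ε * n)
      < (cCoef a b n i : ℝ) * (gcdPow a b n : ℝ) := mul_lt_mul_of_pos_left hg hcpos
    _ = (a : ℝ) ^ ((i : ℕ) * n) * ((a : ℝ) ^ n - 1) := h1
    _ < (a : ℝ) ^ ((i : ℕ) * n) * (a : ℝ) ^ n := by nlinarith
    _ = (a : ℝ) ^ (((i : ℕ) + 1) * n) := by rw [← pow_add]; congr 1; ring
    _ ≤ (a : ℝ) ^ (k * n) :=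
        pow_le_pow_right₀ (by exact_mod_cast ha0) (Nat.mul_le_mul_right n (by omega))
    _ = Real.exp ((k * n : ℕ) * Real.log a) := natCast_pow_eq_exp ha0 _
    _ = Real.exp (k * n * Real.log a) := by push_cast; ring_nf

include hb hn in
/-- `d < bⁿ e^{-εn} = exp(n log b − εn)` when `g > e^{εn}` (B–G: `d ≤ 2|v|^{1−ε}`).
[cite: BombieriGubler2006, proof of Thm. 7.4.10] -/
theorem dCoef_lt_exp (hg : Real.exp (ε * n) < gcdPow a b n) :
    (dCoef a b n : ℝ) < Real.exp (n * Real.log b - ε * n) := by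
  have hb0 : 0 < b := by omega
  have hdpos : (0 : ℝ) < dCoef a b n := by exact_mod_cast dCoef_pos hb hn
  have h1 : (dCoef a b n : ℝ) * (gcdPow a b n : ℝ) = (b : ℝ) ^ n - 1 :=
    dCoef_mul_gcdPow_cast (K := ℝ) hb
  rw [Real.exp_sub, lt_div_iff₀ (Real.exp_pos _)]
  calc (dCoef a b n : ℝ) * Real.exp (ε * n)
      < (dCoef a b n : ℝ) * (gcdPow a b n : ℝ) := mul_lt_mul_of_pos_left hg hdpos
    _ = (b : ℝ) ^ n - 1 := h1
    _ < (b : ℝ) ^ n := by linarith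
    _ = Real.exp (n * Real.log b) := natCast_pow_eq_exp hb0 _

variable (S : Finset ℕ) (hS : ∀ p ∈ S, p.Prime) (haS : a.primeFactors ⊆ S)
  (hbS : b.primeFactors ⊆ S)

include ha hb hk hh hn hS haS hbS in
/-- **B–G (7.15)** for `(u, v) = (aⁿ, bⁿ)`: with `N = k + (k+1)h`,
`∏_{v ∈ S} ∏_m |L_{vm}(x)|_v < a^{k²n} b^{hn} e^{-εnN} = exp(−n E)`,
`E = εN − k² log a − h log b`. [cite: BombieriGubler2006, proof of Thm. 7.4.10] -/
theorem double_product_lt_exp (hg : Real.exp (ε * n) < gcdPow a b n) :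
    (((∏ m, |∑ j, formInf k h m j * (xVec a b k h n j : ℚ)|) *
        ∏ p ∈ S, ∏ m, padicNorm p (∑ j, formFin k h p m j * (xVec a b k h n j : ℚ)) : ℚ) : ℝ) <
      Real.exp (-(n * (ε * ((k : ℝ) + ((k : ℝ) + 1) * h) - (k : ℝ) ^ 2 * Real.log a -
        h * Real.log b))) := by
  have hb0 : 0 < b := by omega
  have h1 := double_product_le ha hb k h hn S hS haS hbS
  have hB : (((b : ℝ) ^ n) ^ h)⁻¹ = Real.exp (-(h * (n * Real.log b))) := by
    rw [Real.exp_neg, Real.exp_nat_mul, ← natCast_pow_eq_exp hb0]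
  -- the two strict bounds
  have hprod : ∏ i : Fin k, (cCoef a b n i : ℝ) * (((b : ℝ) ^ n) ^ h)⁻¹ <
      ∏ _i : Fin k, Real.exp (k * n * Real.log a - ε * n) * Real.exp (-(h * (n * Real.log b))) := by
    refine Finset.prod_lt_prod_of_nonempty (fun i _ => by
      have : (0 : ℝ) < cCoef a b n i := by exact_mod_cast cCoef_pos ha hn i
      positivity) (fun i _ => ?_) ⟨⟨0, hk⟩, Finset.mem_univ _⟩
    rw [hB]
    exact mul_lt_mul_of_pos_right (cCoef_lt_exp ha hn hg i) (Real.exp_pos _)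
  have hpow : (dCoef a b n : ℝ) ^ ((k + 1) * h) <
      (Real.exp (n * Real.log b - ε * n)) ^ ((k + 1) * h) :=
    pow_lt_pow_left₀ (dCoef_lt_exp hb hn hg) (by positivity)
      (Nat.mul_ne_zero (by omega) (by omega))
  calc (((∏ m, |∑ j, formInf k h m j * (xVec a b k h n j : ℚ)|) *
        ∏ p ∈ S, ∏ m, padicNorm p (∑ j, formFin k h p m j * (xVec a b k h n j : ℚ)) : ℚ) : ℝ)
      ≤ (((∏ i : Fin k, (cCoef a b n i : ℚ) * (((b : ℚ) ^ n) ^ h)⁻¹) *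
          (dCoef a b n : ℚ) ^ ((k + 1) * h) : ℚ) : ℝ) := by exact_mod_cast h1
    _ = (∏ i : Fin k, (cCoef a b n i : ℝ) * (((b : ℝ) ^ n) ^ h)⁻¹) *
          (dCoef a b n : ℝ) ^ ((k + 1) * h) := by push_cast; rfl
    _ < (∏ _i : Fin k, Real.exp (k * n * Real.log a - ε * n) *
          Real.exp (-(h * (n * Real.log b)))) *
          (Real.exp (n * Real.log b - ε * n)) ^ ((k + 1) * h) :=
        mul_lt_mul'' hprod hpow (Finset.prod_nonneg fun i _ => by positivity) (by positivity)
    _ = Real.exp (-(n * (ε * ((k : ℝ) + ((k : ℝ) + 1) * h) - (k : ℝ) ^ 2 * Real.log a -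
          h * Real.log b))) := by
        rw [Finset.prod_const, Finset.card_univ, Fintype.card_fin, ← Real.exp_add,
          ← Real.exp_nat_mul, ← Real.exp_nat_mul, ← Real.exp_add]
        congr 1
        push_cast
        ring

include ha hb hk hh hn hS haS hbS in
/-- **The Subspace inequality** for the point `x = x(n)` (B–G p. 220: "`∏ ∏ |L_{νi}(x)|_ν ≪ H(x)^{-δ}`
with `δ = (εn − h − k(k+1)/2)/(h+k+1)`"; here, with cruder constants,
`δ = E/(k log a + h log b)`, `E = ε(k + (k+1)h) − k² log a − h log b > 0`, and no implied
constant since `L_{∞ i}(x) = c_i` exactly): `∏_{v} ∏_m |L_{vm}(x)|_v < ‖x‖^{-δ}`.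
[cite: BombieriGubler2006, proof of Thm. 7.4.10] -/
theorem subspace_ineq (hg : Real.exp (ε * n) < gcdPow a b n) {E logC : ℝ}
    (hE : E = ε * ((k : ℝ) + ((k : ℝ) + 1) * h) - (k : ℝ) ^ 2 * Real.log a - h * Real.log b)
    (hlogC : logC = k * Real.log a + h * Real.log b) (hEpos : 0 < E) (hlogCpos : 0 < logC) :
    (((∏ m, |∑ j, formInf k h m j * (xVec a b k h n j : ℚ)|) *
        ∏ p ∈ S, ∏ m, padicNorm p (∑ j, formFin k h p m j * (xVec a b k h n j : ℚ)) : ℚ) : ℝ) <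
      ((Finset.univ.sup fun j => (xVec a b k h n j).natAbs : ℕ) : ℝ) ^ (-(E / logC)) := by
  refine (double_product_lt_exp ha hb hk hh hn S hS haS hbS hg).trans_le ?_
  rw [← hE]
  have ha0 : (0 : ℝ) < a := by exact_mod_cast (show 0 < a by omega)
  have hb0 : (0 : ℝ) < b := by exact_mod_cast (show 0 < b by omega)
  set H : ℕ := Finset.univ.sup fun j => (xVec a b k h n j).natAbs with hH
  have hH1 : (1 : ℝ) ≤ H := by exact_mod_cast one_le_sup_natAbs_xVec hb k h hn hh (a := a)
  have hHle : (H : ℝ) ≤ ((a : ℝ) ^ k * (b : ℝ) ^ h) ^ n := by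
    exact_mod_cast sup_natAbs_xVec_le ha hb k h hh (n := n)
  rw [Real.rpow_def_of_pos (by linarith), Real.exp_le_exp]
  have hlogH : Real.log H ≤ n * logC := by
    calc Real.log H ≤ Real.log (((a : ℝ) ^ k * (b : ℝ) ^ h) ^ n) :=
          Real.log_le_log (by linarith) hHle
      _ = n * logC := by
          rw [hlogC, Real.log_pow, Real.log_mul (by positivity) (by positivity), Real.log_pow,
            Real.log_pow]
  have hδ : 0 ≤ E / logC := by positivity
  have h2 : Real.log H * (E / logC) ≤ n * logC * (E / logC) :=
    mul_le_mul_of_nonneg_right hlogH hδ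
  have h3 : n * logC * (E / logC) = n * E := by field_simp
  linarith

end RealEstimate

/-! ### Pigeonhole over the finitely many subspaces -/

/-- If every `n` in an infinite set `s ⊆ ℕ` satisfies `Q f n` for some `f` in a finite set `T`,
then one `f ∈ T` serves infinitely many `n ∈ s`. [folklore] -/
theorem exists_mem_infinite_fiber {β : Type*} (T : Finset β) {s : Set ℕ} (hs : s.Infinite)
    {Q : β → ℕ → Prop} (hcover : ∀ n ∈ s, ∃ f ∈ T, Q f n) :
    ∃ f ∈ T, {n | n ∈ s ∧ Q f n}.Infinite := by
  by_contra hcon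
  push Not at hcon
  have hfin : (⋃ f ∈ (T : Set β), {n | n ∈ s ∧ Q f n}).Finite :=
    Set.Finite.biUnion T.finite_toSet fun f hf => hcon f hf
  refine hs (hfin.subset fun n hn => ?_)
  obtain ⟨f, hf, hq⟩ := hcover n hn
  exact Set.mem_biUnion (Finset.mem_coe.mpr hf) ⟨hn, hq⟩

end BugeaudCorvajaZannier2003

open BugeaudCorvajaZannier2003 in
/-- **Bugeaud–Corvaja–Zannier 2003, Theorem 1, from the `p`-adic Subspace Theorem.**
The hypothesis `hST` is the affine `p`-adic Subspace Theorem over `ℚ` for integer points and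
rational linear forms (Schmidt 1972, Schlickewei 1977), verbatim the special case `K = ℚ` of
Bombieri–Gubler Cor. 7.2.5 [BombieriGubler2006]: for a finite index type `ι` with `1 < card ι`, a
finite set `S` of primes, linearly independent families `L` (place `∞`) and `M p` (`p ∈ S`) of
`card ι` linear forms with rational coefficients, and `ε > 0`, the points `x ∈ ℤ^ι ∖ {0}` with
`∏_i |L_i(x)| ∏_{p ∈ S} ∏_i |M_{p,i}(x)|_p < ‖x‖^{-ε}` (`‖x‖ = max |x_j|`) lie in finitely many
proper subspaces `{f = 0}`, `f ∈ T`, `f ≠ 0`. (It is written out as a hypothesis, not as a named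
fact, because a proving seat may not introduce new named facts, D-0026; it is meant to be fed the
discharge of such a fact once the Subspace Theorem is vendored/proved in
`Literature/NumberTheory/DiophantineApproximation`.)

Conclusion: `BugeaudCorvajaZannier2003_thm1` — for multiplicatively independent `a, b ≥ 2` and
`ε > 0`, `gcd(aⁿ − 1, bⁿ − 1) ≤ exp(εn)` for all large `n`.

Proof (Bombieri–Gubler, proof of Thm. 7.4.10 = Corvaja–Zannier [CorvajaZannier2002], for the
pairs `(u,v) = (aⁿ,bⁿ)`; the case treated in [BugeaudCorvajaZannier2003]): if the bound fails for
infinitely many `n`, choose `k` with `kε ≥ log b + 1` and `h ≥ k² log a + 1`; for each bad `n` the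
point `xVec a b k h n ∈ ℤ^{k+(k+1)h}` satisfies the Subspace inequality with
`δ = E/(k log a + h log b)` (`subspace_ineq`, from the exact double product `double_product_le`
and `g > e^{εn}`), so one of finitely many non-zero forms `f` kills `x(n)` for infinitely many
`n` (`exists_mem_infinite_fiber`); then `relPoly k h f` vanishes at `(aⁿ, bⁿ)` for infinitely many
`n` (`eval_relPoly_xVec`), hence is zero (`mvPolynomial_eq_zero_of_infinite_zeros`, using the
multiplicative independence), hence `f = 0` (`eq_zero_of_relPoly_eq_zero`), a contradiction.
[cite: BugeaudCorvajaZannier2003, Thm. 1] -/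
theorem BugeaudCorvajaZannier2003_thm1_of_subspaceTheorem
    (hST : ∀ (ι : Type) [Fintype ι], 1 < Fintype.card ι →
      ∀ (S : Finset ℕ), (∀ p ∈ S, p.Prime) →
      ∀ (L : ι → ι → ℚ), LinearIndependent ℚ L →
      ∀ (M : ℕ → ι → ι → ℚ), (∀ p ∈ S, LinearIndependent ℚ (M p)) →
      ∀ ε : ℝ, 0 < ε →
        ∃ T : Finset (ι → ℚ), (∀ f ∈ T, f ≠ 0) ∧
          ∀ x : ι → ℤ, x ≠ 0 →
            (((∏ i, |∑ j, L i j * x j|) *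
                ∏ p ∈ S, ∏ i, padicNorm p (∑ j, M p i j * x j) : ℚ) : ℝ) <
              ((Finset.univ.sup fun j => (x j).natAbs : ℕ) : ℝ) ^ (-ε) →
            ∃ f ∈ T, ∑ j, f j * x j = 0) :
    BugeaudCorvajaZannier2003_thm1 := by
  intro a b ha hb hind ε hε
  by_contra hcon
  push Not at hcon
  -- Step 0: the infinite set of bad exponents
  set s : Set ℕ := {n | 1 ≤ n ∧ Real.exp (ε * n) < (gcdPow a b n : ℝ)} with hs
  have hsinf : s.Infinite := by
    refine Set.infinite_of_forall_exists_gt fun m => ?_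
    obtain ⟨n, hmn, hn⟩ := hcon (m + 1)
    exact ⟨n, ⟨by omega, hn⟩, by omega⟩
  -- Step 1: the parameters `k`, `h` and the exponents `E`, `δ = E / logC`
  obtain ⟨k₀, hk₀⟩ := exists_nat_ge ((Real.log b + 1) / ε)
  obtain ⟨h₀, hh₀⟩ := exists_nat_ge (((k₀ + 1 : ℕ) : ℝ) ^ 2 * Real.log a + 1)
  set k : ℕ := k₀ + 1 with hk
  set h : ℕ := h₀ + 1 with hh
  have hk1 : 1 ≤ k := by omega
  have hh1 : 1 ≤ h := by omega
  have hkε : Real.log b + 1 ≤ k * ε := by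
    have h1 : (Real.log b + 1) / ε ≤ k := hk₀.trans (by simp [hk])
    rwa [div_le_iff₀ hε] at h1
  have hhb : (k : ℝ) ^ 2 * Real.log a + 1 ≤ h := hh₀.trans (by simp [hh])
  have hloga : 0 ≤ Real.log a := Real.log_nonneg (by exact_mod_cast (by omega : 1 ≤ a))
  have hlogb : 0 < Real.log b := Real.log_pos (by exact_mod_cast (by omega : 1 < b))
  set E : ℝ := ε * ((k : ℝ) + ((k : ℝ) + 1) * h) - (k : ℝ) ^ 2 * Real.log a - h * Real.log b
    with hE
  set logC : ℝ := k * Real.log a + h * Real.log b with hlogC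
  have hk0 : (0 : ℝ) ≤ k := by positivity
  have hh1' : (1 : ℝ) ≤ h := by exact_mod_cast hh1
  have hEpos : 0 < E := by
    have h1 : (h : ℝ) * (Real.log b + 1) ≤ h * (k * ε) := mul_le_mul_of_nonneg_left hkε (by positivity)
    nlinarith [h1, hhb, hloga, hlogb.le, hε, hk0, hh1']
  have hlogCpos : 0 < logC := by
    have : (0 : ℝ) ≤ k * Real.log a := by positivity
    nlinarith
  have hδ : 0 < E / logC := div_pos hEpos hlogCpos
  -- Step 2: the Subspace Theorem for B–G's forms, `S = ` the primes of `ab`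
  set S : Finset ℕ := (a * b).primeFactors with hSdef
  have hS : ∀ p ∈ S, p.Prime := fun p hp => Nat.prime_of_mem_primeFactors hp
  have hab : (a * b).primeFactors = a.primeFactors ∪ b.primeFactors :=
    Nat.primeFactors_mul (by omega) (by omega)
  have haS : a.primeFactors ⊆ S := by rw [hSdef, hab]; exact Finset.subset_union_left
  have hbS : b.primeFactors ⊆ S := by rw [hSdef, hab]; exact Finset.subset_union_right
  have hcard : 1 < Fintype.card (Fin k ⊕ (Fin (k + 1) × Fin h)) := by
    simp only [Fintype.card_sum, Fintype.card_prod, Fintype.card_fin]; nlinarith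
  obtain ⟨T, hT0, hT⟩ := hST (Fin k ⊕ (Fin (k + 1) × Fin h)) hcard S hS (formInf k h)
    (linearIndependent_formInf k h) (formFin k h) (fun p _ => linearIndependent_formFin k h p)
    (E / logC) hδ
  -- Step 3: every bad exponent gives a solution of the Subspace inequality
  have hsol : ∀ n ∈ s, ∃ f ∈ T, ∑ j, f j * (xVec a b k h n j : ℚ) = 0 := by
    rintro n ⟨hn, hg⟩
    exact hT (xVec a b k h n) (xVec_ne_zero hb k h hn hh1)
      (subspace_ineq ha hb hk1 hh1 hn S hS haS hbS hg hE hlogC hEpos hlogCpos)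
  -- Step 4: one of the finitely many forms serves infinitely many exponents
  obtain ⟨f, hfT, hfinf⟩ := exists_mem_infinite_fiber T hsinf hsol
  -- Step 5: the relation polynomial vanishes at `(aⁿ, bⁿ)` for these `n`; so it is `0`; so `f = 0`
  have hP : relPoly k h f = 0 := by
    refine mvPolynomial_eq_zero_of_infinite_zeros ha hb hind _ (hfinf.mono ?_)
    rintro n ⟨⟨-, -⟩, hfn⟩
    simp only [Set.mem_setOf_eq]
    rw [eval_relPoly_xVec ha hb k h f, hfn, mul_zero]
  exact hT0 f hfT (eq_zero_of_relPoly_eq_zero k h f hP)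

end Literature.NumberTheory.DiophantineGeometry
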